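import Summits.ResolutionOfSingularities.ResolutionOfSingularities.Theorems.FrobeniusClosingPatchingRelPerfectDepthRetractionSNCLift
import Summits.ResolutionOfSingularities.ResolutionOfSingularities.Theorems.FrobeniusClosingPatchingRelPerfectDepthSNCPointwise
import Literature.AlgebraicGeometry.Resolution.BoundaryRestriction
import Literature.AlgebraicGeometry.Resolution.BlowupChartMembership
import HarnessLib

/-!
# Chain W5.2 — F5 X-side END, E′-locus: simple normal crossings AT A POINT of a regular hypersurface, lifted from
# the hypersurface with PRESCRIBED members («add the host»)

[OURS · L1 W5.2 · F5 `EndTwoMonomialB`, E′-locus half · res-D-pv-052 AS stub-7] Replaces the role of NO printed item; fact-free.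
Setting: `j : S ⟶ X` a closed immersion whose image is a regular hypersurface near `x = j s` (`(ker j)_x = (t)`, `t ≠ 0`,
`𝒪_{X,x}` regular), a family `FX` of ideal sheaves on `X`, a family `FS` on `S` which has simple normal crossings with a centre
`Z` AT `s` (res-D-pv-009's `DepthSNC.SNCWithAt`, p510013), and an injective TRACE ASSIGNMENT `tr` of the members of `FX` through
`x` to members of `FS` through `s`, each member `D` of `FX` through `x` being principal at `x` with a generator whose image
generates the stalk of `tr D`.  Then (`sncWithAt_cons_lift`) **`(ker j :: FX)` has simple normal crossings with `j_* Z` at `x`**: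
the regular system of parameters of `𝒪_{S,s}` is lifted to `𝒪_{X,x}` choosing the given generators at the positions of the
traces and completed by `t`.  This is the lifting argument of the tree's `BoundaryRel.hasSNCWith_map` (Kollár 3.85 «the role
played by `E`», `Literature/…/BoundaryRestriction.lean`) made POINTWISE and with the X-side members PRESCRIBED rather than
read off a global snc hypothesis on `X` — which is what the END of the mixed engine needs at the points of `i(E′)`: there the
X-side family is `[𝓐] ++ [𝓘_{E′}] ++ 𝒢′` with `𝓐` the reduced host (trace `D′`, NOT globally snc with anything) and `𝒢′` the
X-side boundary (traces `ℬ′`), and the E-side END gives `HasSNC (D′ :: ℬ′)` (res-L1-w52-plan-1's `EndStateB`); the same lemma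
serves res-D-pv-009's birth-step clause at centre points on carriers (`Z = C_j`, `FS = 𝓓 :: 𝒟_j`).

## References
* J. Kollár, *Lectures on Resolution of Singularities* (2007), Cor. 3.85 (proof, p. 158), Def. 3.24. [Kollar2007]
* E. Bierstone, D. Grigoriev, P. Milman, J. Włodarczyk, arXiv:1206.3090, Def. 3.1.1, Def. 3.1.3 (2), Lemma 3.9.4 (3).
  [BierstoneGrigorievMilmanWlodarczyk2011]
* H. Matsumura, *Commutative Ring Theory* (1986), Thm. 14.2. [Matsumura1987]
-/

-- `Summit.<Summit>.<Sub>.Theorems` with `Sub = Summit` (single-conjunct summit, D-0017)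
set_option linter.dupNamespace false

noncomputable section

open CategoryTheory AlgebraicGeometry TopologicalSpace IsLocalRing
open Literature.AlgebraicGeometry.Resolution

namespace Summit.ResolutionOfSingularities.ResolutionOfSingularities.Theorems

universe u

namespace DepthRetract

open DepthSNC

variable {S X : Scheme.{u}} (j : S ⟶ X) [IsClosedImmersion j]

/-- [OURS · L1 W5.2] **Simple normal crossings at a point of a regular hypersurface, lifted with prescribed members.**
`j : S ⟶ X` a closed immersion, `x = j s`, `𝒪_{X,x}` regular, `(ker j)_x = (t)` with `t ≠ 0`; `FS` has simple normal crossings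
with `Z` at `s`; `tr` assigns injectively to each member of `FX` through `x` a member of `FS` through `s`, and each member `D` of
`FX` through `x` has a generator `a` at `x` whose image in `𝒪_{S,s}` generates the stalk of `tr D`.  Then `ker j :: FX` has
simple normal crossings with `j_* Z` at `x` (labels: `ker j ↦ 0`, `D ↦ (label of tr D) + 1`).
[cite: Kollar2007, Cor. 3.85] [cite: BierstoneGrigorievMilmanWlodarczyk2011, Lemma 3.9.4 (3)] [cite: Matsumura1987, Thm. 14.2] -/
theorem sncWithAt_cons_lift (s : S) [IsRegularLocalRing (X.presheaf.stalk (j.base s))]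
    {t : X.presheaf.stalk (j.base s)} (ht : stalkIdeal j.ker (j.base s) = Ideal.span {t}) (ht0 : t ≠ 0)
    {FX : List X.IdealSheafData} {FS : List S.IdealSheafData} {Z : S.IdealSheafData} (hS : SNCWithAt FS Z s)
    (tr : {D : X.IdealSheafData // D ∈ FX ∧ j.base s ∈ D.support} →
      {D' : S.IdealSheafData // D' ∈ FS ∧ s ∈ D'.support})
    (htr : Function.Injective tr)
    (hgen : ∀ D, ∃ a : X.presheaf.stalk (j.base s), stalkIdeal D.1 (j.base s) = Ideal.span {a} ∧
      stalkIdeal (tr D).1 s = Ideal.span {(j.stalkMap s).hom a}) :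
    SNCWithAt (j.ker :: FX) (Z.map j) (j.base s) := by
  classical
  set q := (j.stalkMap s).hom with hqdef
  have hq : Function.Surjective q := j.stalkMap_surjective s
  have hkerq : RingHom.ker q = Ideal.span {t} := by
    rw [hqdef, ker_stalkMap_of_isClosedImmersion j s]; exact ht
  haveI hloc : IsLocalHom q := IsLocalHom.of_surjective q hq
  obtain ⟨hregS, d, wbar, hd, hwbar, ⟨κ, hκinj, hκw⟩, hZs⟩ := hS
  haveI := hregS
  haveI := isDomain_of_isRegularLocalRing (S.presheaf.stalk s)
  -- embedding dimensions: `emb dim 𝒪_{X,x} = d + 1`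
  have hdX : (maximalIdeal (X.presheaf.stalk (j.base s))).spanFinrank = d + 1 := by
    rw [spanFinrank_maximalIdeal_eq_succ q hq hkerq ht0, hd]
  -- generators of the members of `FX` through `x`
  choose gen hgen hgentr using hgen
  let MX : Type u := {D : X.IdealSheafData // D ∈ FX ∧ j.base s ∈ D.support}
  -- the image of `gen D` is associated to the parameter of `tr D`
  have hqgen : ∀ D : MX, Ideal.span {q (gen D)} = Ideal.span {wbar (κ (tr D))} := by
    intro D
    rw [← hκw (tr D), hgentr D]
  -- the lifted system: at the position of `tr D` the generator `gen D`, elsewhere any lift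
  let w : Fin d → X.presheaf.stalk (j.base s) := fun a =>
    if h : ∃ D : MX, κ (tr D) = a then gen h.choose else (hq (wbar a)).choose
  have hw_of : ∀ D : MX, w (κ (tr D)) = gen D := by
    intro D
    have hex : ∃ D₂ : MX, κ (tr D₂) = κ (tr D) := ⟨D, rfl⟩
    show (if h : ∃ D₂ : MX, κ (tr D₂) = κ (tr D) then gen h.choose else (hq (wbar (κ (tr D)))).choose) = gen D
    rw [dif_pos hex]
    have h2 : hex.choose = D := htr (hκinj hex.choose_spec)
    rw [h2]
  have hqw : ∀ a, Associated (q (w a)) (wbar a) := by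
    intro a
    by_cases hex : ∃ D : MX, κ (tr D) = a
    · obtain ⟨D, rfl⟩ := hex
      rw [hw_of D, ← Ideal.span_singleton_eq_span_singleton]
      exact hqgen D
    · show Associated (q (if h : ∃ D : MX, κ (tr D) = a then gen h.choose else (hq (wbar a)).choose)) (wbar a)
      rw [dif_neg hex, (hq (wbar a)).choose_spec]
  -- the completed system `z = (t, w)`
  let z : Fin (d + 1) → X.presheaf.stalk (j.base s) := Fin.cons t w
  have hz0 : z 0 = t := Fin.cons_zero _ _
  have hzs : ∀ a, z a.succ = w a := fun a => Fin.cons_succ _ _ a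
  have hspan_qw : Ideal.span (Set.range (q ∘ w)) = maximalIdeal (S.presheaf.stalk s) := by
    rw [← hwbar]; exact Ideal.span_range_eq_of_associated hqw
  have ht𝔪 : t ∈ maximalIdeal (X.presheaf.stalk (j.base s)) := by
    have h1 : t ∈ RingHom.ker q := by rw [hkerq]; exact Ideal.mem_span_singleton_self t
    exact ker_le_maximalIdeal q h1
  have hzspan : Ideal.span (Set.range z) = maximalIdeal (X.presheaf.stalk (j.base s)) := by
    apply le_antisymm
    · rw [Ideal.span_le]
      rintro _ ⟨a, rfl⟩
      refine Fin.cases ?_ (fun b => ?_) a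
      · rw [hz0]; exact ht𝔪
      · rw [hzs]
        have h1 : q (w b) ∈ maximalIdeal (S.presheaf.stalk s) :=
          hspan_qw ▸ Ideal.subset_span ⟨b, rfl⟩
        exact (map_mem_nonunits_iff q (w b)).mp h1
    · intro m hm
      have h1 : q m ∈ (Ideal.span (Set.range w)).map q := by
        rw [Ideal.map_span, ← Set.range_comp, hspan_qw, ← map_maximalIdeal_of_surjective q hq]
        exact Ideal.mem_map_of_mem q hm
      rw [Ideal.mem_map_iff_of_surjective q hq] at h1
      obtain ⟨m', hm', hmm'⟩ := h1
      have h2 : m - m' ∈ RingHom.ker q := by rw [RingHom.mem_ker, map_sub, hmm', sub_self]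
      rw [hkerq] at h2
      have h3 : m = (m - m') + m' := by ring
      rw [h3]
      refine Ideal.add_mem _ ?_ ?_
      · refine Ideal.span_mono ?_ h2
        rintro _ rfl; exact ⟨0, hz0⟩
      · refine Ideal.span_mono ?_ hm'
        rintro _ ⟨b, rfl⟩; exact ⟨b.succ, hzs b⟩
  -- the labels of the members of `ker j :: FX` through `x`
  let MX' : Type u := {D : X.IdealSheafData // D ∈ j.ker :: FX ∧ j.base s ∈ D.support}
  have hmemFX : ∀ D : MX', D.1 ≠ j.ker → D.1 ∈ FX := fun D hD =>
    (List.mem_cons.mp D.2.1).resolve_left hD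
  let toMX : ∀ D : MX', D.1 ≠ j.ker → MX := fun D hD => ⟨D.1, hmemFX D hD, D.2.2⟩
  let lab : MX' → Fin (d + 1) := fun D =>
    if hD : D.1 ≠ j.ker then (κ (tr (toMX D hD))).succ else 0
  have hlab_of : ∀ (D : MX') (hD : D.1 ≠ j.ker), lab D = (κ (tr (toMX D hD))).succ := fun D hD => by
    simp only [lab, dif_pos hD]
  have hlab_H : ∀ D : MX', D.1 = j.ker → lab D = 0 := fun D h => by
    simp only [lab, h, ne_eq, not_true_eq_false, dite_false]
  refine ⟨inferInstance, d + 1, z, hdX, hzspan, ⟨lab, ?_, ?_⟩, ?_⟩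
  · -- injectivity of the labels
    intro D₁ D₂ h
    by_cases h₁ : D₁.1 = j.ker <;> by_cases h₂ : D₂.1 = j.ker
    · exact Subtype.ext (h₁.trans h₂.symm)
    · rw [hlab_H D₁ h₁, hlab_of D₂ h₂] at h; exact absurd h (Fin.succ_ne_zero _).symm
    · rw [hlab_of D₁ h₁, hlab_H D₂ h₂] at h; exact absurd h (Fin.succ_ne_zero _)
    · rw [hlab_of D₁ h₁, hlab_of D₂ h₂] at h
      have h' := htr (hκinj (Fin.succ_injective _ h))
      exact Subtype.ext (congrArg (fun D : MX => D.1) h')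
  · -- the stalks
    intro D
    by_cases hD : D.1 = j.ker
    · rw [hlab_H D hD, hz0, ← ht]
      exact congrArg (stalkIdeal · (j.base s)) hD
    · rw [hlab_of D hD, hzs, hw_of (toMX D hD)]
      exact hgen (toMX D hD)
  · -- the centre `j_* Z`
    intro hxZ
    have hsZ : s ∈ Z.support := (apply_mem_support_map_iff j Z s).mp hxZ
    obtain ⟨T, hT⟩ := hZs hsZ
    refine ⟨insert 0 (Fin.succ '' T), ?_⟩
    have hA : stalkIdeal (Z.map j) (j.base s) = (stalkIdeal Z s).comap q := by
      have h1 : (stalkIdeal (Z.map j) (j.base s)).map q = stalkIdeal Z s := by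
        rw [← stalkIdeal_comap_eq_map_stalkMap, comap_map_of_isClosedImmersion]
      rw [← h1, Ideal.comap_map_of_surjective q hq, ← RingHom.ker_eq_comap_bot, hkerq]
      refine (sup_eq_left.mpr ?_).symm
      rw [← ht]
      exact stalkIdeal_mono (ker_le_map Z j) (j.base s)
    have hT' : stalkIdeal Z s = (Ideal.span (w '' T)).map q := by
      rw [hT, Ideal.map_span, ← Set.image_comp]
      exact span_image_eq_of_associated (fun a => (hqw a).symm) T
    rw [hA, hT', Ideal.comap_map_of_surjective q hq, ← RingHom.ker_eq_comap_bot, hkerq,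
      Set.image_insert_eq, Ideal.span_insert, hz0, sup_comm, ← Set.image_comp]
    congr 1

/-- **Distinct members of an snc family through a point of the regular hypersurface `V(ker j)` (itself a member), other than the
hypersurface, have distinct traces on `S`**: their parameters map to two distinct members of the induced regular system of
parameters of `𝒪_{S,s} = 𝒪_{X,x}/(t)`, which are not associated. [cite: Matsumura1987, Thm. 14.2] -/
theorem stalkIdeal_comap_ne_of_sncWithAt (s : S) {FX : List X.IdealSheafData} {C : X.IdealSheafData}
    (hX : SNCWithAt (j.ker :: FX) C (j.base s)) {D₁ D₂ : X.IdealSheafData} (h₁ : D₁ ∈ FX) (h₂ : D₂ ∈ FX)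
    (hx₁ : j.base s ∈ D₁.support) (hx₂ : j.base s ∈ D₂.support) (hne : D₁ ≠ D₂)
    (hk₁ : D₁ ≠ j.ker) (hk₂ : D₂ ≠ j.ker) :
    stalkIdeal (D₁.comap j) s ≠ stalkIdeal (D₂.comap j) s := by
  classical
  obtain ⟨hreg, d, v, hd, hv, ⟨ι, hιinj, hιv⟩, -⟩ := hX
  haveI := hreg
  set q := (j.stalkMap s).hom with hqdef
  have hq : Function.Surjective q := j.stalkMap_surjective s
  let AH : {D : X.IdealSheafData // D ∈ j.ker :: FX ∧ j.base s ∈ D.support} :=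
    ⟨j.ker, List.mem_cons_self, apply_mem_support_ker j s⟩
  let A₁ : {D : X.IdealSheafData // D ∈ j.ker :: FX ∧ j.base s ∈ D.support} :=
    ⟨D₁, List.mem_cons_of_mem _ h₁, hx₁⟩
  let A₂ : {D : X.IdealSheafData // D ∈ j.ker :: FX ∧ j.base s ∈ D.support} :=
    ⟨D₂, List.mem_cons_of_mem _ h₂, hx₂⟩
  set c₀ := ι AH with hc₀
  obtain ⟨n, rfl⟩ : ∃ n, d = n + 1 := Nat.exists_eq_succ_of_ne_zero (Fin.pos c₀).ne'
  have hkerq : RingHom.ker q = Ideal.span {v c₀} := by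
    rw [hqdef, ker_stalkMap_of_isClosedImmersion j s]; exact hιv AH
  obtain ⟨hregS, hfr, hspanq⟩ := rsop_quotient_succAbove q hq hd v hv c₀ hkerq
  haveI := hregS
  haveI := isDomain_of_isRegularLocalRing (S.presheaf.stalk s)
  have hz : IsRsopPart ((q ∘ v ∘ c₀.succAbove) ∘ id) :=
    isRsopPart_comp_of_rsop hfr _ hspanq id Function.injective_id
  have hι₁ : ι A₁ ≠ c₀ := fun h => hk₁ (congrArg Subtype.val (hιinj h))
  have hι₂ : ι A₂ ≠ c₀ := fun h => hk₂ (congrArg Subtype.val (hιinj h))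
  obtain ⟨t₁, ht₁⟩ := Fin.exists_succAbove_eq hι₁
  obtain ⟨t₂, ht₂⟩ := Fin.exists_succAbove_eq hι₂
  have ht : t₁ ≠ t₂ := by
    intro h
    apply hne
    have h' : ι A₁ = ι A₂ := by rw [← ht₁, ← ht₂, h]
    exact congrArg Subtype.val (hιinj h')
  intro heq
  rw [stalkIdeal_comap_eq_map_stalkMap, stalkIdeal_comap_eq_map_stalkMap] at heq
  change (stalkIdeal D₁ (j.base s)).map q = (stalkIdeal D₂ (j.base s)).map q at heq
  rw [hιv A₁, hιv A₂, Ideal.map_span, Ideal.map_span, Set.image_singleton, Set.image_singleton,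
    Ideal.span_singleton_eq_span_singleton] at heq
  apply hz.not_associated ht
  simp only [Function.comp_apply, id_eq, ht₁, ht₂]
  exact heq

/-- [OURS · L1 W5.2] **«Add the host»: the END family at a point of `i(E)`.** `i : E ⟶ X` a closed immersion with `ker i` an
effective Cartier divisor, `𝓐` (the reduced host) and the members of the X-side boundary `𝒢` effective Cartier, with TRACES
`𝓐|_E = D'` and `𝒢|_E = ℬ` (as lists), `D' ∉ ℬ`; if `(ker i :: 𝒢)` has simple normal crossings at `x = i y` (any centre) and
`(D' :: ℬ)` has simple normal crossings with `Z` at `y`, then `(𝓐 :: ker i :: 𝒢)` has simple normal crossings with `i_* Z` at `x`.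
The E′-locus half of res-L1-w52-plan-1's `EndTwoMonomialB` (with `Z = ⊤`, `(D', ℬ)` from `EndStateB`) and res-D-pv-009's birth-step
clause at centre points on carriers (with `Z = C_j`). NO cylinder / flatness hypothesis: only traces.
[cite: Kollar2007, Cor. 3.85] [cite: BierstoneGrigorievMilmanWlodarczyk2011, Def. 3.1.3 (2), Lemma 3.9.4 (3)] -/
theorem sncWithAt_host_cons {E : Scheme.{u}} (i : E ⟶ X) [IsClosedImmersion i] (hker : IsEffectiveCartier i.ker) (y : E)
    {𝓐 : X.IdealSheafData} (h𝓐 : IsEffectiveCartier 𝓐) {D' : E.IdealSheafData} (h𝓐D : 𝓐.comap i = D')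
    {𝒢 : List X.IdealSheafData} {ℬ : List E.IdealSheafData} (h𝒢 : ∀ G ∈ 𝒢, IsEffectiveCartier G)
    (hal : 𝒢.map (fun G => G.comap i) = ℬ) (hD' : D' ∉ ℬ)
    {C : X.IdealSheafData} (hX : SNCWithAt (i.ker :: 𝒢) C (i.base y))
    {Z : E.IdealSheafData} (hE : SNCWithAt (D' :: ℬ) Z y) :
    SNCWithAt (𝓐 :: i.ker :: 𝒢) (Z.map i) (i.base y) := by
  classical
  haveI := hX.isRegularLocalRing
  obtain ⟨t, ht, hkt⟩ := IsEffectiveCartier.exists_stalkIdeal_eq_span hker (i.base y)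
  have ht0 : t ≠ 0 := nonZeroDivisors.ne_zero ht
  set q := (i.stalkMap y).hom with hqdef
  haveI hloc : IsLocalHom q := IsLocalHom.of_surjective q (i.stalkMap_surjective y)
  -- traces of the members of `𝓐 :: 𝒢`
  have htrace_mem : ∀ D ∈ 𝓐 :: 𝒢, D.comap i ∈ D' :: ℬ := by
    intro D hD
    rcases List.mem_cons.mp hD with rfl | hD
    · rw [h𝓐D]; exact List.mem_cons_self
    · rw [← hal]; exact List.mem_cons_of_mem _ (List.mem_map_of_mem hD)
  have htrace_supp : ∀ D : X.IdealSheafData, i.base y ∈ D.support → y ∈ (D.comap i).support := by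
    intro D hx
    rw [mem_support_iff_stalkIdeal_le] at hx ⊢
    rw [stalkIdeal_comap_eq_map_stalkMap]
    change (stalkIdeal D (i.base y)).map q ≤ _
    rw [← map_maximalIdeal_of_surjective q (i.stalkMap_surjective y)]
    exact Ideal.map_mono hx
  -- the E-side data at `y`: stalks of members through `y` are non-zero
  have hEnz : ∀ B ∈ D' :: ℬ, y ∈ B.support → stalkIdeal B y ≠ ⊥ := by
    obtain ⟨hregE, d, wbar, hd, hwbar, ⟨κ, -, hκw⟩, -⟩ := hE
    haveI := hregE
    intro B hB hy h0
    have hrs : IsRsopPart (wbar ∘ id) := isRsopPart_comp_of_rsop hd wbar hwbar id Function.injective_id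
    have h1 := hκw ⟨B, hB, hy⟩
    rw [h0, eq_comm, Ideal.span_singleton_eq_bot] at h1
    exact hrs.ne_zero (κ ⟨B, hB, hy⟩) h1
  -- no member of `𝓐 :: 𝒢` through `x` is the hypersurface
  have hneker : ∀ D ∈ 𝓐 :: 𝒢, i.base y ∈ D.support → D ≠ i.ker := by
    intro D hD hx hDk
    refine hEnz (D.comap i) (htrace_mem D hD) (htrace_supp D hx) ?_
    rw [hDk, stalkIdeal_comap_eq_map_stalkMap]
    change (stalkIdeal i.ker (i.base y)).map q = ⊥
    rw [← ker_stalkMap_of_isClosedImmersion i y, Ideal.map_eq_bot_iff_le_ker]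
  -- the trace assignment
  let tr : {D : X.IdealSheafData // D ∈ 𝓐 :: 𝒢 ∧ i.base y ∈ D.support} →
      {B : E.IdealSheafData // B ∈ D' :: ℬ ∧ y ∈ B.support} :=
    fun D => ⟨D.1.comap i, htrace_mem D.1 D.2.1, htrace_supp D.1 D.2.2⟩
  have htr : Function.Injective tr := by
    intro D₁ D₂ h
    have h' : D₁.1.comap i = D₂.1.comap i := congrArg Subtype.val h
    by_contra hne
    have hne' : D₁.1 ≠ D₂.1 := fun h'' => hne (Subtype.ext h'')
    rcases List.mem_cons.mp D₁.2.1 with e₁ | m₁ <;> rcases List.mem_cons.mp D₂.2.1 with e₂ | m₂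
    · exact hne' (e₁.trans e₂.symm)
    · apply hD'
      rw [← h𝓐D, ← e₁, h', ← hal]
      exact List.mem_map_of_mem m₂
    · apply hD'
      rw [← h𝓐D, ← e₂, ← h', ← hal]
      exact List.mem_map_of_mem m₁
    · exact stalkIdeal_comap_ne_of_sncWithAt i y hX m₁ m₂ D₁.2.2 D₂.2.2 hne'
        (hneker _ D₁.2.1 D₁.2.2) (hneker _ D₂.2.1 D₂.2.2) (congrArg (stalkIdeal · y) h')
  have hgen : ∀ D : {D : X.IdealSheafData // D ∈ 𝓐 :: 𝒢 ∧ i.base y ∈ D.support},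
      ∃ a : X.presheaf.stalk (i.base y), stalkIdeal D.1 (i.base y) = Ideal.span {a} ∧
        stalkIdeal (tr D).1 y = Ideal.span {(i.stalkMap y).hom a} := by
    intro D
    have hDc : IsEffectiveCartier D.1 := by
      rcases List.mem_cons.mp D.2.1 with e | m
      · rw [e]; exact h𝓐
      · exact h𝒢 D.1 m
    obtain ⟨a, -, ha⟩ := IsEffectiveCartier.exists_stalkIdeal_eq_span hDc (i.base y)
    refine ⟨a, ha, ?_⟩
    change stalkIdeal (D.1.comap i) y = _
    rw [stalkIdeal_comap_eq_map_stalkMap]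
    change (stalkIdeal D.1 (i.base y)).map q = _
    rw [ha, Ideal.map_span, Set.image_singleton]
  have h := sncWithAt_cons_lift i y hkt ht0 hE tr htr hgen
  exact h.congr_mem fun D _ => by simp only [List.mem_cons]; tauto

end DepthRetract

end Summit.ResolutionOfSingularities.ResolutionOfSingularities.Theorems

end
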